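import Mathlib
import Summits.KontsevichZagierPeriods.Zeta5Search.BrickLevelReductionTwo

/-!
# BrickBlockWeightTwo — the block and hole weights of the centre-free brick kernel at the prime `2`: WHERE PARITY ENTERS.
`W` on an ODD row is `≡ 0 (mod 2^B)` for ANY `2`-integral weight; on an EVEN row `W(K) = ±φ_0·g(2K)` is a UNIT multiple of
`g(2K)`; the hole weight is `≡ 0 (mod 2^A)` for any weight (cell `pub-zeta5`, seat ct-1 g42)

HONEST FRAMING: systematic search; no irrationality claim unless certified.  INSTRUMENT valuations of the chain's
`BrickLevelReduction.blockWeight A B 0 2 n₀ N g` and `BrickHoleWeight.holeWeight A B 0 2 0 N g` (the weights of the one-level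
reduction at `2`, `BrickLevelReductionTwo`); nothing about `ζ(5)`/`ζ(3)`; no `γ`/record statement; records in print UNMOVED;
NOTHING IS DISCHARGED (net named-fact debt 0).

WHY: in the zeta5-irr chain the step after the reduction is `BrickBlockWeight.blockWeight_le` — `W(K) ≡ 0 (mod p)` — proved from
the admissibility of `g` ((S) antisymmetry + (D) digit-locality) through `S₀ ≡ −S₀ ⇒ 2S₀ ≡ 0 ⇒ S₀ ≡ 0`, which is VACUOUS at
`p = 2`.  This file records what IS true at `2` with no hypothesis on `g` beyond integrality, and isolates the one place where a
parity hypothesis is needed: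

* **`blockWeight_two_odd_le`** — odd row `2N+1` (`n₀ = 1`): `v₂(W(K)) ≤ exp(−B)` for every `g ∈ ℤ_(2)`, because both
  top-coefficient ratios `λ = 2^B w_0`, `2^B w′_0` carry `2^B` (`BrickResidueLawTwo.cTop_two_odd_*`); so `ω = W/2 ∈ ℤ_(2)` for free
  when `B ≥ 1`;
* **`blockWeight_two_even_eq`**, **`padicValuation_blockWeight_two_even`** — even row `2N+2` (`n₀ = 0`):
  `W(K) = g(2K)·(−1)^{(N+1)B}φ_0` and `v₂(W(K)) = v₂(g(2K))` (`φ_0` a unit, `BrickPhiAllPrimes`): **`W(K) ≡ 0 (mod 2)` iff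
  `g(2K)` is even** — the parity hypothesis a `p = 2` induction must carry on even rows (true for `g = n − 2k`, `n` even);
* **`holeWeight_two_le`** — `v₂(G(K)) ≤ exp(−A)·v₂(g(2K+1)) ≤ exp(−A)` for every `g ∈ ℤ_(2)` (`μ = 2^A h_0`, `BrickHoleResidueLawTwo`).

DATA (seat desk `alg/`, exact): along the whole descent tree of `g = n − 2k` for `(6,1,0)`, `n ≤ 64` (2111 weights, 1056 on even
rows), an odd value at an even pole of an even row NEVER occurs.  Theorems only (0 `def`); tree vocabulary; nothing restated.
-/

namespace Summit.KontsevichZagierPeriods.Zeta5Search.BrickBlockWeightTwo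

open Finset Nat Polynomial WithZero
open Summit.KontsevichZagierPeriods.Zeta5Search.BrickTopCoefficient (cTop)
open Summit.KontsevichZagierPeriods.Zeta5Search.BrickLaurent (expandAt phiCoeff)
open Summit.KontsevichZagierPeriods.Zeta5Search.ScaledSeries (IsSlopeInt)
open Summit.KontsevichZagierPeriods.Zeta5Search.BrickLambda (cTop_zero_ne_zero)
open Summit.KontsevichZagierPeriods.Zeta5Search.BrickLevelReduction (blockWeight)
open Summit.KontsevichZagierPeriods.Zeta5Search.BrickHoleWeight (holeWeight)
open Summit.KontsevichZagierPeriods.Zeta5Search.BrickPhiAllPrimes (padicValuation_phiCoeff_zero_eq_one)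
open Summit.KontsevichZagierPeriods.Zeta5Search.BrickFrobeniusTwoOddRow (isSlopeInt_psiSeries)
open Summit.KontsevichZagierPeriods.Zeta5Search.BrickFrobeniusTwoOddRowEven (isSlopeInt_psi'Series)
open Summit.KontsevichZagierPeriods.Zeta5Search.BrickHatTwoCells (isSlopeInt_hatSeries)
open Summit.KontsevichZagierPeriods.Zeta5Search.BrickResidueLawTwo (cTop_two_even cTop_two_odd_odd cTop_two_odd_even
  padicValuation_two_pow)
open Summit.KontsevichZagierPeriods.Zeta5Search.BrickHoleResidueLawTwo (cTop_two_hat)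

noncomputable section

/-- **Odd row: `W(K) ≡ 0 (mod 2^B)` for ANY `2`-integral weight.**  For `K ≤ N`, `2B ≤ A` and `g(2K), g(2K+1) ∈ ℤ_(2)`:
`v₂(blockWeight A B 0 2 1 N g K) ≤ exp(−B)`. -/
theorem blockWeight_two_odd_le {A B : ℕ} (hAB : 2 * B ≤ A) {N K : ℕ} (hK : K ≤ N) {g : ℕ → ℚ}
    (hge : Rat.padicValuation 2 (g (2 * K)) ≤ 1) (hgo : Rat.padicValuation 2 (g (2 * K + 1)) ≤ 1) :
    Rat.padicValuation 2 (blockWeight A B 0 2 1 N g K) ≤ exp (-(B : ℤ)) := by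
  have hc0 : cTop A B 0 N K ≠ 0 := cTop_zero_ne_zero hK A B
  rw [blockWeight, Finset.sum_range_succ, Finset.sum_range_one, zero_add, show 1 + N * 2 = 2 * N + 1 by ring,
    show K * 2 = 2 * K by ring, show 1 + 2 * K = 2 * K + 1 by ring, cTop_two_odd_even hAB hK, cTop_two_odd_odd hAB hK,
    mul_div_cancel_right₀ _ hc0, mul_div_cancel_right₀ _ hc0]
  have he := isSlopeInt_psi'Series A B N K 0
  have ho := isSlopeInt_psiSeries A B N K 0
  rw [zero_mul, zero_add, exp_zero] at he ho
  refine (Valuation.map_add _ _ _).trans (max_le ?_ ?_) <;> rw [map_mul, map_mul, padicValuation_two_pow]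
  · calc _ ≤ 1 * (exp (-(B : ℤ)) * 1) := mul_le_mul' hge (mul_le_mul' le_rfl he)
      _ = _ := by rw [one_mul, mul_one]
  · calc _ ≤ 1 * (exp (-(B : ℤ)) * 1) := mul_le_mul' hgo (mul_le_mul' le_rfl ho)
      _ = _ := by rw [one_mul, mul_one]

/-- **Even row: the block weight is a UNIT multiple of `g(2K)`.**  For `K ≤ N+1`, `2B ≤ A`:
`blockWeight A B 0 2 0 (N+1) g K = g(2K)·((−1)^{(N+1)B}·φ_0)`, `φ_0 = phiCoeff A B 2 (N+1) K 0`. -/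
theorem blockWeight_two_even_eq {A B : ℕ} (hAB : 2 * B ≤ A) {N K : ℕ} (hK : K ≤ N + 1) (g : ℕ → ℚ) :
    blockWeight A B 0 2 0 (N + 1) g K = g (2 * K) * ((-1) ^ ((N + 1) * B) * phiCoeff A B 2 (N + 1) K 0) := by
  have hc0 : cTop A B 0 (N + 1) K ≠ 0 := cTop_zero_ne_zero hK A B
  rw [blockWeight, Finset.sum_range_one, zero_add, zero_add, show K * 2 = 2 * K by ring,
    show 2 * K = K * 2 by ring, cTop_two_even hAB hK, mul_div_cancel_right₀ _ hc0, show K * 2 = 2 * K by ring]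

/-- **Even row: `v₂(W(K)) = v₂(g(2K))`** — so `W(K) ≡ 0 (mod 2)` EXACTLY when `g(2K)` is even: the parity hypothesis a `p = 2`
induction must carry on even rows. -/
theorem padicValuation_blockWeight_two_even {A B : ℕ} (hAB : 2 * B ≤ A) {N K : ℕ} (hK : K ≤ N + 1) (g : ℕ → ℚ) :
    Rat.padicValuation 2 (blockWeight A B 0 2 0 (N + 1) g K) = Rat.padicValuation 2 (g (2 * K)) := by
  rw [blockWeight_two_even_eq hAB hK, map_mul, map_mul, map_pow, Valuation.map_neg, map_one, one_pow, one_mul,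
    padicValuation_phiCoeff_zero_eq_one, mul_one]

/-- **The hole weight is `≡ 0 (mod 2^A)` for ANY `2`-integral weight**: for `K ≤ N`, `2B ≤ A`, `g(2K+1) ∈ ℤ_(2)`:
`v₂(holeWeight A B 0 2 0 N g K) ≤ exp(−A)`. -/
theorem holeWeight_two_le {A B : ℕ} (hAB : 2 * B ≤ A) {N K : ℕ} (hK : K ≤ N) {g : ℕ → ℚ}
    (hgo : Rat.padicValuation 2 (g (2 * K + 1)) ≤ 1) :
    Rat.padicValuation 2 (holeWeight A B 0 2 0 N g K) ≤ exp (-(A : ℤ)) := by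
  have hc0 : cTop A B 0 N K ≠ 0 := cTop_zero_ne_zero hK A B
  rw [holeWeight, zero_add, Nat.Ico_succ_singleton, Finset.sum_singleton, zero_add, show (N + 1) * 2 = 2 * N + 2 by ring,
    show 1 + K * 2 = 2 * K + 1 by ring, cTop_two_hat hAB hK, mul_div_cancel_right₀ _ hc0]
  have hh := isSlopeInt_hatSeries A B N K 0
  rw [zero_mul, zero_add, exp_zero] at hh
  rw [map_mul, map_mul, padicValuation_two_pow]
  calc _ ≤ 1 * (exp (-(A : ℤ)) * 1) := mul_le_mul' hgo (mul_le_mul' le_rfl hh)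
    _ = _ := by rw [one_mul, mul_one]

end

end Summit.KontsevichZagierPeriods.Zeta5Search.BrickBlockWeightTwo
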